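import Mathlib
import HarnessLib
import Literature.MathematicalPhysics.QuantumLattice.FermiRG.BGM2003Sectors
import Summits.HubbardSuperconductivity.HubbardSuperconductivity.Theorems.KLProgrammeThinLevelSetDispersionChart

/-!
# Route `KLProgramme` — K3 engine (stmt-HubbardSuperconductivity-20437), stub (b) (ℓ)/(I2)–(I3), located item «ABS-UMK-COUNT»:
# lattice points in thin level sets, part 10 — the polar graph chart of BGM 2003's Fermi curve WITH CONSTANTS EXPLICIT IN THE GEOMETRIC DATA

Cell gate-hubbard-kl, seat p4 g15.  Uniform twin of part 9 (`exists_fermiChart_of_dispersionHyp`, whose six constants are existential and depend on the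
dispersion): if the `DispersionHyp` datum comes with a radius floor `c_u ≤ u`, ONE bound `M` on `|u|, |u′|, |u″|` and a curvature floor `c_κ ≤ 1/r` on the
shell (exactly the data (u1), (u4)′ the lineage supplies UNIFORMLY over the programme's frames, `…PerturbedChartBounds`), then the chart package of
part 9 holds at every base angle with the EXPLICIT constants
`s₁ = c_u`, `Φ = c_u/(8M)`, `c_f = c_κc_u³/(2M)³`, `A_f = 8(M² + 2M² + M·M)/c_u³`, `B_f = 2(M + M)/c_u`, `M₁ = M + M`:

* **`exists_fermiChart_of_bounds`** — the θ⋆-uniform chart package with these constants.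

Everything is PROVED; no definitions, no named facts. [cite: BenfattoGiulianiMastropietro2003, §1.2 (2.8a) p.4 (L106) and §7.1 (A1.1)–(A1.7) p.26 (L16–52)]
-/

noncomputable section

open Real Set Filter Topology
open Literature.MathematicalPhysics.QuantumLattice Literature.MathematicalPhysics.QuantumLattice.FermiRG
open Literature.MathematicalPhysics.QuantumLattice.FermiRG.BGM2003

namespace Summit.HubbardSuperconductivity.HubbardSuperconductivity.Theorems.ThinLevelSet

set_option linter.dupNamespace false -- summit = problem name (single-conjunct summit), D-0017

variable {ε : (Fin 2 → ℝ) → ℝ} {μ e₀ : ℝ} {u : ℝ → ℝ → ℝ}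

/-- **The polar graph chart of BGM 2003's Fermi curve, constants explicit in `(c_u, M, c_κ)`.**  See the module docstring.
[cite: BenfattoGiulianiMastropietro2003, §1.2 (2.8a) p.4 (L106) and §7.1 (A1.1)–(A1.7) p.26 (L16–52)] -/
theorem exists_fermiChart_of_bounds (hD : DispersionHyp ε μ e₀ u) {cu M cκ : ℝ} (hcu : 0 < cu) (hcκ : 0 < cκ)
    (hupos : ∀ θ e : ℝ, |e| ≤ e₀ → cu ≤ u θ e)
    (hM : ∀ θ e : ℝ, |e| ≤ e₀ → |u θ e| ≤ M ∧ |radiusDeriv u θ e| ≤ M ∧ |radiusDeriv₂ u θ e| ≤ M)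
    (hconv : ∀ θ e : ℝ, |e| ≤ e₀ → cκ ≤ curvature u θ e) :
    ∀ θs : ℝ, ∃ f f' f'' : ℝ → ℝ, Measurable f ∧
      (∀ φ ∈ Icc (-(cu / (8 * M))) (cu / (8 * M)),
        f ((fermiPoint u (θs + φ) - fermiPoint u θs) ⬝ᵥ tdir θs) = -((fermiPoint u (θs + φ) - fermiPoint u θs) ⬝ᵥ dir θs)) ∧
      (∀ y ∈ Icc (-(cu / 4 * (cu / (8 * M)))) (cu / 4 * (cu / (8 * M))), HasDerivAt f (f' y) y ∧ HasDerivAt f' (f'' y) y ∧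
        cκ * cu ^ 3 / (M + M) ^ 3 ≤ f'' y ∧ f'' y ≤ 8 * (M ^ 2 + 2 * M ^ 2 + M * M) / cu ^ 3 ∧ |f' y| ≤ 2 * (M + M) / cu) ∧
      (∀ φ ∈ Icc (-(cu / (8 * M))) (cu / (8 * M)), ∀ φ' ∈ Icc (-(cu / (8 * M))) (cu / (8 * M)),
        cu / 2 * |φ - φ'| ≤ |(fermiPoint u (θs + φ) - fermiPoint u θs) ⬝ᵥ tdir θs - (fermiPoint u (θs + φ') - fermiPoint u θs) ⬝ᵥ tdir θs| ∧
        |(fermiPoint u (θs + φ) - fermiPoint u θs) ⬝ᵥ tdir θs - (fermiPoint u (θs + φ') - fermiPoint u θs) ⬝ᵥ tdir θs| ≤ (M + M) * |φ - φ'|) ∧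
      (fermiPoint u (θs + 0) - fermiPoint u θs) ⬝ᵥ tdir θs = 0 := by
  intro θs
  -- the radius and its derivatives
  set r : ℝ → ℝ := fun θ => u θ 0 with hr_def
  set r' : ℝ → ℝ := fun θ => radiusDeriv u θ 0 with hr'_def
  set r'' : ℝ → ℝ := fun θ => radiusDeriv₂ u θ 0 with hr''_def
  have hsmooth : ContDiff ℝ ((⊤ : ℕ∞) : WithTop ℕ∞) r := contDiff_fermiRadius hD
  have hr'eq : r' = deriv r := by
    funext θ; rw [hr'_def, hr_def]; simp only [radiusDeriv]
  have hsmooth' : ContDiff ℝ ((⊤ : ℕ∞) : WithTop ℕ∞) r' := by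
    rw [hr'eq]; exact (contDiff_infty_iff_deriv.1 hsmooth).2
  have hr''eq : r'' = deriv r' := by
    funext θ; rw [hr''_def, hr'_def]; simp only [radiusDeriv₂]
  have hr : ∀ θ, HasDerivAt r (r' θ) θ := fun θ => by
    rw [hr'eq]; exact ((hsmooth.differentiable (by simp)).differentiableAt).hasDerivAt
  have hr' : ∀ θ, HasDerivAt r' (r'' θ) θ := fun θ => by
    rw [hr''eq]; exact ((hsmooth'.differentiable (by simp)).differentiableAt).hasDerivAt
  -- the bounds at `e = 0`
  have h0 : |(0 : ℝ)| ≤ e₀ := by rw [abs_zero]; exact hD.e₀_pos.le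
  have hrb : ∀ θ, |r θ| ≤ M := fun θ => (hM θ 0 h0).1
  have hr'b : ∀ θ, |r' θ| ≤ M := fun θ => (hM θ 0 h0).2.1
  have hr''b : ∀ θ, |r'' θ| ≤ M := fun θ => (hM θ 0 h0).2.2
  have hMpos : 0 < M := by
    have h1 := hupos θs 0 h0; have h2 := (le_abs_self _).trans (hrb θs)
    rw [hr_def] at h2; simp only at h2; linarith
  have hD₀ : 0 < cκ * cu ^ 3 := by positivity
  have hDfloor : ∀ θ, cκ * cu ^ 3 ≤ r θ ^ 2 + 2 * r' θ ^ 2 - r θ * r'' θ := fun θ =>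
    curvatureNumerator_ge_of_dispersionHyp hD hcκ hconv hcu hupos θ
  -- the window
  have hΦ : 0 < cu / (8 * M) := by positivity
  have hΦM : cu / (8 * M) * (M + 2 * M + M) ≤ cu / 2 := by
    rw [show M + 2 * M + M = 4 * M by ring]
    rw [div_mul_eq_mul_div, div_le_iff₀ (by positivity)]
    nlinarith [hcu.le, hMpos.le]
  have hframe : cu ≤ r' θs * Real.sin (θs - θs) + r θs * Real.cos (θs - θs) := by
    rw [sub_self, Real.sin_zero, Real.cos_zero, mul_zero, zero_add, mul_one]
    exact hupos θs 0 h0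
  obtain ⟨f, f', f'', hfm, hval, hder, -, hlip, hU0⟩ :=
    exists_polar_graph hr hr' hD₀ hrb hr'b hr''b hDfloor θs θs hcu hΦ hframe hΦM
  refine ⟨f, f', f'', hfm, ?_, ?_, ?_, ?_⟩
  · intro φ hφ
    rw [fermiPoint_eq_smul_dir, fermiPoint_eq_smul_dir]
    exact hval φ hφ
  · intro y hy
    exact hder y hy
  · intro φ hφ φ' hφ'
    rw [fermiPoint_eq_smul_dir, fermiPoint_eq_smul_dir, fermiPoint_eq_smul_dir]
    exact hlip φ hφ φ' hφ'
  · rw [fermiPoint_eq_smul_dir, fermiPoint_eq_smul_dir]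
    exact hU0

end Summit.HubbardSuperconductivity.HubbardSuperconductivity.Theorems.ThinLevelSet

end
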